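/-
Copyright (c) 2026 the pub-hodgecm-mathlib formalisation cell (harness21).  Prover seat hodgecm-mathlib-K2E1-p10 (g6), Track B ∕ K2-LIT, h413 =
`stmt-HodgeConjecture-24833`, route `HCCMUnconditional`; R90-TF S8 «ContSpec-n½», (M) road RES-INT line 7 «PACKAGING» (census
`K2/K2E1-p10/g6/CENSUS-LINE7-Packaging.K2E1-p10-g6.md` d2e571fc812fd5b2, step (7a); «=» by silence 03:04Z).
-/
import Summits.HodgeConjecture.HodgeConjecture.Theorems.R90S8IsotypicSubquotientU3   -- ★ p864408 (K2Liu-p10): `isIsotypicOfType_finsupp_simple`, `nonempty_linearEquiv_quotient_of_isIsotypicOfType`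
import HarnessLib

/-!
# R90 · S8 «ContSpec-n½» — `R90S8ResMidConstituentOfEquivariantMapU3`: RES-INT line 7 (7a), the PURE ALGEBRA — the range of a map (of a family of maps)
# that KILLS the kernel of a reduction to a semisimple `S`-isotypic module is SEMISIMPLE and `S`-ISOTYPIC; so every non-zero submodule of it contains a
# simple submodule `≅ S`, and EVERY simple subquotient of it is `≅ S` [Jacobson1989BasicAlgebraII §3.5; Lang2002 XVII §1–§2; MoeglinWaldspurger1995 IV.1.11 (the use)]

Cell `pub/hodgecm-mathlib`, crux H413 = `stmt-HodgeConjecture-24833` (lane `--kind proof --supports stmt-HodgeConjecture-24833 --as helper`), route of record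
`HCCMUnconditional`; programme R90-TF, section S8, the (M) socket road, RES-INT line 7.  THEOREMS ONLY, Mathlib-level module algebra (no `def`, no `instance`, no `notation`, no
`sorry`); default heartbeats.  CLOSES NO SOCKET.

THE USE (census d2e571fc812fd5b2 (4)).  `R := ℂ[G_v]`; `I := i_G(χ_{ξ,v})` (★ `cmPrincipalSeries`) with `K := K_v` ORIENT's maximal proper `G_v`-stable subspace (★ `Rogawski1990.KeysOrientation`
(iii)), so `S := I ⧸ K = πⁿ(ξ_v)` is simple; `Φ_i : I → W` (`i` ranging over finitely many away-from-`v` data `φᵛ_i`) the maps «`x_v ↦ Res (ι x_v φᵛ_i)`» — `G_v`-equivariant (★ LIN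
p864683 + line 6 ★ p864700) and KILLING `K` because `ker Res ⊇ ker M₋₁` (★ KER p864667) and `M₋₁ (ι x_v φᵛ) = ιʷ (N_v x_v) (M₋₁ᵛ φᵛ)` with `N_v(K_v) = 0` (FACT-N: ★ p864847 F0P2-p11 operator
factorisation + LH4-p10 `…IntertwiningResidueKernelOfFactorisation…` + K2Liu-p10 J-S8-FN (a)).  CONCLUSION (§3): the `G_v`-span `⨆ i, range Φ_i = Res(span)` is semisimple and
`πⁿ`-isotypic; every non-zero `G_v`-submodule of it — e.g. `P′ ⊓ Res(span)` once (7d) «`P′ ∩ Res(V_τ) ≠ 0`» — CONTAINS an irreducible `Z ≅ I ⧸ K`, and every irreducible subquotient of it is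
`≅ I ⧸ K`: a QUOTIENT of `i_G(χ_{ξ,v})`, i.e. ★ p864766's pin (QUOT-N) once ONE such `Z` is read as a constituent of `P′` (by ★ hAF one class per place; (7b)–(7c)).

THE MATHEMATICS (§1, the engine).  `π : M → N` with `N` semisimple `S`-isotypic, `Θ : M → W` with `ker π ≤ ker Θ`: `Θ` factors through `M ⧸ ker π ≅ range π =: P ≤ N` as `h : P → W` with
`range h = range Θ`; `P` is semisimple (submodule of `N`), so `range h` is semisimple (Mathlib `IsSemisimpleModule.range`) and `ker h` has a complement `C ≤ P` with
`C ≅ P ⧸ ker h ≅ range h`; `C ↪ N` makes it — hence `range Θ` — `S`-isotypic (Mathlib `IsIsotypicOfType.of_injective`).  §1 also records the submodule form (`Θ` on `T ≤ M`) and the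
quotient form (`M ⧸ Q ≅ ι →₀ S`, `Θ` killing `T ∩ Q`).  §2: inside a semisimple `S`-isotypic submodule `V ≤ W`, every non-zero `U ≤ V` contains a simple `Z ≅ S` (semisimplicity and isotypy
pass to `U` along `U ↪ V`; Mathlib `IsSemisimpleModule.exists_simple_submodule`) and every simple subquotient `N₁ ∕ N₂` (`N₂ ≤ N₁ ≤ V`) is `≅ S` (★ `nonempty_linearEquiv_quotient_of_isIsotypicOfType`
on `N₁`).  §3 = §1 ∘ §2 for a FAMILY `Φ_i : I → W` killing `K` with `I ⧸ K` simple (`Θ := Σ_i Φ_i` on `ι →₀ I`, `π :=` coefficientwise reduction mod `K` into `ι →₀ (I ⧸ K)`, which is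
semisimple and `(I ⧸ K)`-isotypic by ★ `isIsotypicOfType_finsupp_simple`; `range Θ = ⨆ i, range Φ_i`).
* §1 `isSemisimpleModule_and_isIsotypicOfType_range_of_ker_le` (engine) · `…_range_of_forall_apply_eq_zero` (submodule form) · `…_range_of_forall_mem` (quotient form).
* §2 `exists_simple_submodule_le_of_isIsotypicOfType` · `nonempty_linearEquiv_of_simple_subquotient_of_isIsotypicOfType`.
* §3 **`isSemisimpleModule_and_isIsotypicOfType_iSup_range_of_le_ker`** · **`exists_simple_submodule_le_iSup_range_of_le_ker`** · **`nonempty_linearEquiv_quotient_of_subquotient_iSup_range_of_le_ker`**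
  — the three heads (7b) reads at `R := MonoidAlgebra ℂ G_v` through the tree's `k[G]`-module dictionary (★ `Literature/RepresentationTheory/Semisimple/SubrepresentationEquiv`:
  `Subrepresentation.asModuleEquiv`, `Representation.Equiv.ofAsModuleLinearEquiv`, `Subrepresentation.isIrreducible_toRepresentation_iff`) and ★ `IrrClass.isConstituentOf_mk_of_injective`.
HONEST LABEL: HC_CM is proved only modulo the 7 printed citations (2 remaining named inputs: hLiu418 = `stmt-HodgeConjecture-24832`, h413 = `stmt-HodgeConjecture-24833`) until
rung 0 closes; pure algebra, pays no socket; count-neutral.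

## References
* [Jacobson1989BasicAlgebraII] N. Jacobson, *Basic Algebra II*, 2nd ed. (1989), §3.5 (completely reducible modules, isotypic components).
* [Lang2002] S. Lang, *Algebra*, rev. 3rd ed., GTM 211 (2002), XVII §1 Prop. 1.2, §2.
* [MoeglinWaldspurger1995] C. Mœglin, J.-L. Waldspurger, *Spectral Decomposition and Eisenstein Series* (1995), IV.1.11, V.3.13.
-/

set_option autoImplicit false
set_option linter.dupNamespace false  -- the mandated namespace `…HodgeConjecture.HodgeConjecture.R90.S8` repeats the summit's segment

namespace Summit.HodgeConjecture.HodgeConjecture.R90.S8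

variable {R : Type*} [Ring R] {M W S : Type*} [AddCommGroup M] [Module R M] [AddCommGroup W] [Module R W] [AddCommGroup S] [Module R S]

/-! ## §1 The engine: the range of a map killing `ker π`, `π` into a semisimple `S`-isotypic module -/

/-- **ENGINE.**  `π : M → N` with `N` semisimple and `S`-isotypic, `Θ : M → W` with `ker π ≤ ker Θ`: then `range Θ` is semisimple and `S`-isotypic — `Θ` factors through the image
`P ≤ N` of `π`, `range` of the factored map `h : P → W` is semisimple with `P`, and a complement of `ker h` inside `P` injects `range h = range Θ` into `N`.
[cite: Jacobson1989BasicAlgebraII, §3.5] [cite: Lang2002, XVII §2] -/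
theorem isSemisimpleModule_and_isIsotypicOfType_range_of_ker_le {N : Type*} [AddCommGroup N] [Module R N] [IsSemisimpleModule R N]
    (hN : IsIsotypicOfType R N S) (π : M →ₗ[R] N) (Θ : M →ₗ[R] W) (hker : LinearMap.ker π ≤ LinearMap.ker Θ) :
    IsSemisimpleModule R (LinearMap.range Θ) ∧ IsIsotypicOfType R (LinearMap.range Θ) S := by
  -- `Θ` factors through `M ⧸ ker π ≅ range π =: P ≤ N` as `h`
  set Θq : (M ⧸ LinearMap.ker π) →ₗ[R] W := (LinearMap.ker π).liftQ Θ hker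
  have hrangeq : LinearMap.range Θq = LinearMap.range Θ := Submodule.range_liftQ _ _ _
  set P : Submodule R N := LinearMap.range π
  set e1 : (M ⧸ LinearMap.ker π) ≃ₗ[R] P := π.quotKerEquivRange
  set h : P →ₗ[R] W := Θq.comp e1.symm.toLinearMap with hh
  have hrangeh : LinearMap.range h = LinearMap.range Θ := by
    rw [hh, LinearMap.range_comp_of_range_eq_top _ (LinearEquiv.range e1.symm), hrangeq]
  -- `range h` is semisimple with `P`; a complement `C` of `ker h` in `P` is `≅ range h` and injects into `N`
  have hssh : IsSemisimpleModule R (LinearMap.range h) := IsSemisimpleModule.range h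
  obtain ⟨C, ⟨eC⟩⟩ := IsSemisimpleModule.exists_submodule_linearEquiv_quotient (LinearMap.ker h)
  have hinj : Function.Injective (P.subtype.comp C.subtype) := P.subtype_injective.comp C.subtype_injective
  have hisoC : IsIsotypicOfType R C S := hN.of_injective _ hinj
  have e : C ≃ₗ[R] LinearMap.range h := eC.trans h.quotKerEquivRange
  have hisoh : IsIsotypicOfType R (LinearMap.range h) S := (e.isIsotypicOfType_iff (S := S)).1 hisoC
  exact ⟨hrangeh ▸ hssh, hrangeh ▸ hisoh⟩

/-- **SUBMODULE FORM.**  `π : M → N` (`N` semisimple `S`-isotypic), `T ≤ M`, `Θ : T → W` vanishing wherever `π` does: `range Θ` is semisimple and `S`-isotypic (§1 engine for `π ∘ incl_T`).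
[cite: Jacobson1989BasicAlgebraII, §3.5] [cite: Lang2002, XVII §2] -/
theorem isSemisimpleModule_and_isIsotypicOfType_range_of_forall_apply_eq_zero {N : Type*} [AddCommGroup N] [Module R N] [IsSemisimpleModule R N]
    (hN : IsIsotypicOfType R N S) (π : M →ₗ[R] N) (T : Submodule R M) (Θ : T →ₗ[R] W) (hker : ∀ x : T, π x = 0 → Θ x = 0) :
    IsSemisimpleModule R (LinearMap.range Θ) ∧ IsIsotypicOfType R (LinearMap.range Θ) S :=
  isSemisimpleModule_and_isIsotypicOfType_range_of_ker_le hN (π.comp T.subtype) Θ fun x hx =>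
    LinearMap.mem_ker.2 (hker x (LinearMap.mem_ker.1 hx))

/-- **QUOTIENT FORM** (the census wording: `T ≤ M = I^{⊕ι}`, `Q = K^{⊕ι}`, `M ⧸ Q ≅ (I ⧸ K)^{⊕ι}`).  `M ⧸ Q ≅ ι →₀ S` with `S` simple, `T ≤ M`, `Θ : T → W` killing `T ∩ Q`: `range Θ` is semisimple and
`S`-isotypic (§1 for `π := (M → M ⧸ Q ≅ ι →₀ S)`, which is semisimple and `S`-isotypic by ★ `isIsotypicOfType_finsupp_simple`). [cite: Jacobson1989BasicAlgebraII, §3.5] [cite: Lang2002, XVII §1 Prop. 1.2, §2] -/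
theorem isSemisimpleModule_and_isIsotypicOfType_range_of_forall_mem (hS : IsSimpleModule R S) {ι : Type*} (Q : Submodule R M) (eQ : (M ⧸ Q) ≃ₗ[R] (ι →₀ S))
    (T : Submodule R M) (Θ : T →ₗ[R] W) (hker : ∀ x : T, (x : M) ∈ Q → Θ x = 0) :
    IsSemisimpleModule R (LinearMap.range Θ) ∧ IsIsotypicOfType R (LinearMap.range Θ) S := by
  haveI := hS
  refine isSemisimpleModule_and_isIsotypicOfType_range_of_forall_apply_eq_zero (N := ι →₀ S) isIsotypicOfType_finsupp_simple
    (eQ.toLinearMap.comp Q.mkQ) T Θ fun x hx => hker x ?_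
  rw [LinearMap.comp_apply, LinearEquiv.coe_coe, LinearEquiv.map_eq_zero_iff, Submodule.mkQ_apply, Submodule.Quotient.mk_eq_zero] at hx
  exact hx

/-! ## §2 Inside a semisimple `S`-isotypic submodule: simple submodules below any non-zero submodule, simple subquotients -/

/-- **A NON-ZERO SUBMODULE OF A SEMISIMPLE `S`-ISOTYPIC SUBMODULE CONTAINS A SIMPLE SUBMODULE `≅ S`.**  For `V ≤ W` semisimple and `S`-isotypic and `0 ≠ U ≤ V`: semisimplicity and isotypy pass to
`U` along `U ↪ V`, a semisimple non-trivial module has a simple submodule, and it is `≅ S`. [cite: Jacobson1989BasicAlgebraII, §3.5] [cite: Lang2002, XVII §2] -/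
theorem exists_simple_submodule_le_of_isIsotypicOfType (V : Submodule R W) (hss : IsSemisimpleModule R V) (hiso : IsIsotypicOfType R V S)
    (U : Submodule R W) (hUV : U ≤ V) (hU : U ≠ ⊥) :
    ∃ Z : Submodule R W, Z ≤ U ∧ IsSimpleModule R Z ∧ Nonempty (Z ≃ₗ[R] S) := by
  haveI := hss
  haveI : IsSemisimpleModule R U := IsSemisimpleModule.of_injective (Submodule.inclusion hUV) (Submodule.inclusion_injective hUV)
  have hisoU : IsIsotypicOfType R U S := hiso.of_injective (Submodule.inclusion hUV) (Submodule.inclusion_injective hUV)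
  haveI : Nontrivial U := Submodule.nontrivial_iff_ne_bot.2 hU
  obtain ⟨m, hm⟩ := IsSemisimpleModule.exists_simple_submodule (R := R) (M := U)
  haveI := hm
  have em : m ≃ₗ[R] Submodule.map U.subtype m := Submodule.equivMapOfInjective U.subtype U.subtype_injective m
  obtain ⟨e⟩ := hisoU m
  exact ⟨Submodule.map U.subtype m, Submodule.map_subtype_le U m, IsSimpleModule.congr em.symm, ⟨em.symm.trans e⟩⟩

/-- **EVERY SIMPLE SUBQUOTIENT OF A SEMISIMPLE `S`-ISOTYPIC SUBMODULE IS `≅ S`.**  For `V ≤ W` semisimple and `S`-isotypic and submodules `N₂, N₁` of `W` with `N₁ ≤ V` and the quotient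
`N₁ ⧸ (N₁ ⊓ N₂)` (spelled `↥N₁ ⧸ Submodule.comap N₁.subtype N₂`, the tree's subquotient shape) simple, that quotient is `≅ S` (`N₁` is semisimple and `S`-isotypic along `N₁ ↪ V`;
★ `nonempty_linearEquiv_quotient_of_isIsotypicOfType`). [cite: Jacobson1989BasicAlgebraII, §3.5] [cite: Lang2002, XVII §2] -/
theorem nonempty_linearEquiv_of_simple_subquotient_of_isIsotypicOfType (V : Submodule R W) (hss : IsSemisimpleModule R V) (hiso : IsIsotypicOfType R V S)
    (N₁ N₂ : Submodule R W) (h1V : N₁ ≤ V) (hQ : IsSimpleModule R (↥N₁ ⧸ Submodule.comap N₁.subtype N₂)) :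
    Nonempty ((↥N₁ ⧸ Submodule.comap N₁.subtype N₂) ≃ₗ[R] S) := by
  haveI := hss
  haveI := hQ
  haveI : IsSemisimpleModule R N₁ := IsSemisimpleModule.of_injective (Submodule.inclusion h1V) (Submodule.inclusion_injective h1V)
  have hiso1 : IsIsotypicOfType R N₁ S := hiso.of_injective (Submodule.inclusion h1V) (Submodule.inclusion_injective h1V)
  exact nonempty_linearEquiv_quotient_of_isIsotypicOfType hiso1 _

/-! ## §3 The heads line 7 consumes: a family of maps `Φ_i : I → W` killing `K`, `I ⧸ K` simple -/

/-- The range of `Σ_i Φ_i : (ι →₀ I) → W` is the span `⨆ i, range Φ_i` of the ranges. [folklore; Mathlib `Finsupp.lsum`] -/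
theorem range_lsum_eq_iSup_range {I : Type*} [AddCommGroup I] [Module R I] {ι : Type*} (Φ : ι → (I →ₗ[R] W)) :
    LinearMap.range (Finsupp.lsum ℕ Φ) = ⨆ i, LinearMap.range (Φ i) := by
  apply le_antisymm
  · rintro _ ⟨x, rfl⟩
    rw [Finsupp.lsum_apply, Finsupp.sum]
    exact Submodule.sum_mem _ fun i _ => Submodule.mem_iSup_of_mem i (LinearMap.mem_range_self (Φ i) (x i))
  · refine iSup_le fun i => ?_
    rintro _ ⟨m, rfl⟩
    exact ⟨Finsupp.single i m, by rw [Finsupp.lsum_single]⟩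

/-- **STRUCTURE THEOREM FOR A FAMILY KILLING `K`.**  `K ≤ I` with `I ⧸ K` simple, `Φ_i : I → W` (`i ∈ ι`) with `K ≤ ker Φ_i` for every `i`: the span `⨆ i, range Φ_i` is semisimple and
`(I ⧸ K)`-isotypic (§1 engine with `Θ := Σ_i Φ_i` on `ι →₀ I` and `π :=` the coefficientwise reduction `ι →₀ I → ι →₀ (I ⧸ K)`, semisimple and isotypic by ★ `isIsotypicOfType_finsupp_simple`).
(«`Res` of the `G_v`-span of the K-finite sections through finitely many away-from-`v` data is a semisimple `πⁿ(ξ_v)`-isotypic `G_v`-module».)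
[cite: Jacobson1989BasicAlgebraII, §3.5] [cite: Lang2002, XVII §1 Prop. 1.2, §2] [cite: MoeglinWaldspurger1995, IV.1.11] -/
theorem isSemisimpleModule_and_isIsotypicOfType_iSup_range_of_le_ker {I : Type*} [AddCommGroup I] [Module R I] (K : Submodule R I) (hK : IsSimpleModule R (I ⧸ K))
    {ι : Type*} (Φ : ι → (I →ₗ[R] W)) (hker : ∀ i, K ≤ LinearMap.ker (Φ i)) :
    IsSemisimpleModule R ↥(⨆ i, LinearMap.range (Φ i)) ∧ IsIsotypicOfType R ↥(⨆ i, LinearMap.range (Φ i)) (I ⧸ K) := by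
  haveI := hK
  have key := isSemisimpleModule_and_isIsotypicOfType_range_of_ker_le (N := ι →₀ (I ⧸ K)) (S := I ⧸ K) isIsotypicOfType_finsupp_simple
    (Finsupp.mapRange.linearMap K.mkQ) (Finsupp.lsum ℕ Φ) fun x hx => by
      rw [LinearMap.mem_ker] at hx ⊢
      have hi : ∀ i, x i ∈ K := fun i => by
        have h := DFunLike.congr_fun hx i
        rw [Finsupp.mapRange.linearMap_apply, Finsupp.mapRange_apply, Finsupp.coe_zero, Pi.zero_apply, Submodule.mkQ_apply,
          Submodule.Quotient.mk_eq_zero] at h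
        exact h
      rw [Finsupp.lsum_apply, Finsupp.sum]
      exact Finset.sum_eq_zero fun i _ => LinearMap.mem_ker.1 (hker i (hi i))
  rw [range_lsum_eq_iSup_range] at key
  exact key

/-- **HEAD 1 — A NON-ZERO SUBMODULE OF THE SPAN CONTAINS A SIMPLE SUBMODULE `≅ I ⧸ K`.**  With `K, Φ` as in the structure theorem and `0 ≠ U ≤ ⨆ i, range Φ_i`: `∃ Z ≤ U` simple with `Z ≅ I ⧸ K`.
(«once `P′ ⊓ Res(span) ≠ 0`, `P′|_{G_v}` CONTAINS an irreducible `G_v`-subrepresentation isomorphic to `I_v ⧸ K_v = πⁿ(ξ_v)`, a quotient of `i_G(χ_{ξ,v})`» — the constituent (7b) hands to ★ p864766's (QUOT-N).)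
[cite: Jacobson1989BasicAlgebraII, §3.5] [cite: MoeglinWaldspurger1995, IV.1.11] -/
theorem exists_simple_submodule_le_iSup_range_of_le_ker {I : Type*} [AddCommGroup I] [Module R I] (K : Submodule R I) (hK : IsSimpleModule R (I ⧸ K))
    {ι : Type*} (Φ : ι → (I →ₗ[R] W)) (hker : ∀ i, K ≤ LinearMap.ker (Φ i)) (U : Submodule R W) (hU : U ≤ ⨆ i, LinearMap.range (Φ i)) (hU0 : U ≠ ⊥) :
    ∃ Z : Submodule R W, Z ≤ U ∧ IsSimpleModule R Z ∧ Nonempty (Z ≃ₗ[R] (I ⧸ K)) := by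
  obtain ⟨hss, hiso⟩ := isSemisimpleModule_and_isIsotypicOfType_iSup_range_of_le_ker K hK Φ hker
  exact exists_simple_submodule_le_of_isIsotypicOfType _ hss hiso U hU hU0

/-- **HEAD 2 — EVERY SIMPLE SUBQUOTIENT OF THE SPAN IS `≅ I ⧸ K`.**  With `K, Φ` as in the structure theorem and submodules `N₂, N₁` of `W` with `N₁ ≤ ⨆ i, range Φ_i` and `N₁ ⧸ (N₁ ⊓ N₂)` simple:
`N₁ ⧸ (N₁ ⊓ N₂) ≅ I ⧸ K`.  («every irreducible `G_v`-subquotient of `Res(span)` — in particular every constituent of `P′` at `v` it carries — is `πⁿ(ξ_v)`, a QUOTIENT of `i_G(χ_{ξ,v})`».)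
[cite: Jacobson1989BasicAlgebraII, §3.5] [cite: Lang2002, XVII §2] [cite: MoeglinWaldspurger1995, IV.1.11] -/
theorem nonempty_linearEquiv_quotient_of_subquotient_iSup_range_of_le_ker {I : Type*} [AddCommGroup I] [Module R I] (K : Submodule R I)
    (hK : IsSimpleModule R (I ⧸ K)) {ι : Type*} (Φ : ι → (I →ₗ[R] W)) (hker : ∀ i, K ≤ LinearMap.ker (Φ i)) (N₁ N₂ : Submodule R W)
    (h1 : N₁ ≤ ⨆ i, LinearMap.range (Φ i)) (hQ : IsSimpleModule R (↥N₁ ⧸ Submodule.comap N₁.subtype N₂)) :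
    Nonempty ((↥N₁ ⧸ Submodule.comap N₁.subtype N₂) ≃ₗ[R] (I ⧸ K)) := by
  obtain ⟨hss, hiso⟩ := isSemisimpleModule_and_isIsotypicOfType_iSup_range_of_le_ker K hK Φ hker
  exact nonempty_linearEquiv_of_simple_subquotient_of_isIsotypicOfType _ hss hiso N₁ N₂ h1 hQ

end Summit.HodgeConjecture.HodgeConjecture.R90.S8
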